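import Mathlib
import Summits.QuantumFields.BalabanUV.Beta.FP.PerfectRepBasePoint
import Summits.QuantumFields.BalabanUV.Beta.FP.RepAssembly

/-!
# Road «FP» (binder row D1), N7 — SEAM CERTIFICATE: REP-F (leaf-02-g3's base-point currency of record) ∘ the owner's `hrep` assembly socket

ONE composition, no new mathematics: `PerfectRepBasePoint.secondMoment_TPerfOf_perfect_eq_basePoint` (the perfect coefficient in the `_avg`
END's currency, K-side hypothesis-free; S/Wf class data + coarse covariance + symmetry, Ward rows `hrow` (N3-fine) and base-point parity `hT1`
displayed) fed to `RepAssembly.hrep_of_basePoint_uniform` (window LEGS `hlegs`, shell TAILS `htail`), giving the `hrep` binder of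
`FP/AsymptoticEndAvg.hasym_of_legInterface_avg` AT ONE BLOCKING `n = Lc^m` with `c₀ = 0`, `Bset := resSite '' (Fin 4 → Fin n)`, `wt := n⁻⁴`:

  **`hrep_perfect_of_rows`**: `|secondMoment (TPerfOf n (KPerf … m) S (vertex2OfK (KPerf … m) n Wf)) μ ν − 0
      − Σ_{b ∈ Bset} n⁻⁴ · Σ_{w ∈ annulus 4 0 R₀} w_μ w_ν Σ_i cc₀ i · F′ b i w · G′ b i w| ≤ U₁ + 80·E·(1 + Lr/δ)`.

So the typed residual of road FP's N7 at each blocking is EXACTLY {`hrow`, `hT1`, `hlegs`, `htail`} (+ the END's leg envelopes `hF`/`hG`/tails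
against `PerfectLegTable.perfP/perfQ` and their germ bounds `herr` = GERM-K).  [folklore] bookkeeping; nothing about Bałaban's objects is asserted
beyond the displayed hypotheses.  HONEST FRAMING: bookkeeping toward `hident` (GAPS O-asym1-7); discharges nothing of `BetaPertH`; NOT the
continuum limit, NOT Clay.
-/

noncomputable section

open Finset Filter Topology
open scoped BigOperators

namespace Summit.QuantumFields.BalabanUV.Beta.FP.RepSeam

open Literature.Probability.LatticeModels (annulus)
open Literature.MathematicalPhysics.QuantumFieldTheory.Balaban1983to89
open Literature.MathematicalPhysics.QuantumFieldTheory.Balaban1983to89.Beta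
open ExpKernelCalculus (Site MKer Decays BiLoc shiftK)
open DressedMomentNormalisation (resSite)
open WindowIdentification (psum fullSum)
open DyadicShell (Pt toReal)
open OneStepResolventKernel (Fib LocStencil)
open AxialProjector (coProj)
open AxialDressing (axDressK)
open SecondOrderResponse (vertex2OfK)
open Summit.QuantumFields.BalabanUV.Beta.GAN24.CombesThomas (sfStep smStep)
open Summit.QuantumFields.BalabanUV.Beta.D1BFx.MomentTransferPeriodic (baseKer)
open Summit.QuantumFields.BalabanUV.Beta.D1BFx.ReducedKernelSandwichLeg (fineHessA)
open Summit.QuantumFields.BalabanUV.Beta.FP.PerfectObjectsT (KPerf TPerfOf)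
open Summit.QuantumFields.BalabanUV.Beta.FP.PerfectRepBasePoint (basePoint_weights secondMoment_TPerfOf_perfect_eq_basePoint)
open Summit.QuantumFields.BalabanUV.Beta.FP.RepAssembly (hrep_of_basePoint_uniform)

variable {Lc : ℕ} [NeZero Lc]

/-- [folklore] **SEAM: REP-F ∘ `hrep` assembly at the perfect family, one blocking `n = Lc^m`.**  Hypotheses = those of
`secondMoment_TPerfOf_perfect_eq_basePoint` + the typed LEGS/TAILS rows; conclusion = the `hrep` shape of `AsymptoticEndAvg`. -/
theorem hrep_perfect_of_rows (hLc : 2 ≤ Lc) {m : ℕ} (hm : 1 ≤ m)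
    {S : Fin (3 + 1) → (Fin (3 + 1) → ℤ) → MKer (3 + 1) (Fib 3)} {Cs δs : ℝ} (hS : LocStencil S Cs δs) (hδs : 0 < δs)
    (hScov : ∀ κ u t, S κ (u + ((Lc ^ m : ℕ) : ℤ) • t) = shiftK (-(((Lc ^ m : ℕ) : ℤ) • t)) (S κ u))
    {Wf : Fin (3 + 1) → (Fin (3 + 1) → ℤ) → Fin (3 + 1) → (Fin (3 + 1) → ℤ) → MKer (3 + 1) (Fib 3)} {C2 δ2 : ℝ}
    (hW : ∀ κ' u l' u', BiLoc (Wf κ' u l' u') u u' C2 δ2) (hδ2 : 0 < δ2)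
    (hWcov : ∀ κ' u l' u' t, Wf κ' (u + ((Lc ^ m : ℕ) : ℤ) • t) l' (u' + ((Lc ^ m : ℕ) : ℤ) • t)
      = shiftK (-(((Lc ^ m : ℕ) : ℤ) • t)) (Wf κ' u l' u'))
    (hWsymm : ∀ (κ' : Fin 4) (u : Site 4) (l' : Fin 4) (u' : Site 4), Wf κ' u l' u' = Wf l' u' κ' u)
    (hrow : ∀ (κ' l' : Fin 4) (b : Site 4),
      HasSum (fineHessA (axDressK (Lc ^ m) (KPerf (d := 3) Lc (sfStep Lc) (smStep 3 Lc) m)) (coProj (Lc ^ m) S) Wf κ' l' b) 0)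
    (hT1 : ∀ (κ' l' μ' : Fin 4), ∑ r : Fin 4 → Fin (Lc ^ m), ∑' t, (t μ' : ℝ) *
      baseKer (fineHessA (axDressK (Lc ^ m) (KPerf (d := 3) Lc (sfStep Lc) (smStep 3 Lc) m)) (coProj (Lc ^ m) S) Wf κ' l')
        (resSite r) t = 0)
    (μ ν : Fin 4)
    -- the typed analytic rows
    {ι : Type*} {s : Finset ι} {cc₀ : ι → ℝ} {F' G' : (Fin 4 → ℤ) → ι → Pt → ℝ} {R₀ M : ℕ} (hMR : M ≤ R₀)
    {U₁ E δ Lr : ℝ} (hE : 0 ≤ E) (hδ : 0 < δ) (hL : 0 < Lr)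
    (hlegs : ∀ b ∈ (univ : Finset (Fin 4 → Fin (Lc ^ m))).image resSite,
      |psum (fun w : Pt => ((((Lc ^ m : ℕ) : ℝ)) ^ 8)⁻¹ * (toReal w μ * toReal w ν *
          baseKer (fineHessA (axDressK (Lc ^ m) (KPerf (d := 3) Lc (sfStep Lc) (smStep 3 Lc) m)) (coProj (Lc ^ m) S) Wf μ ν) b w)) R₀
        - ∑ w ∈ annulus 4 0 R₀, toReal w μ * toReal w ν * ∑ i ∈ s, cc₀ i * (F' b i w * G' b i w)| ≤ U₁)
    (htail : ∀ b ∈ (univ : Finset (Fin 4 → Fin (Lc ^ m))).image resSite, ∀ r : ℕ, M ≤ r → ∀ w ∈ annulus 4 r (r + 1),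
      |((((Lc ^ m : ℕ) : ℝ)) ^ 8)⁻¹ * (toReal w μ * toReal w ν *
          baseKer (fineHessA (axDressK (Lc ^ m) (KPerf (d := 3) Lc (sfStep Lc) (smStep 3 Lc) m)) (coProj (Lc ^ m) S) Wf μ ν) b w)|
        ≤ E / ((r : ℝ) + 1) ^ 4 * Real.exp (-(δ / Lr) * ((r : ℝ) + 1))) :
    |B12Beta.secondMoment (TPerfOf (Lc ^ m) (KPerf (d := 3) Lc (sfStep Lc) (smStep 3 Lc) m) S
          (vertex2OfK (KPerf (d := 3) Lc (sfStep Lc) (smStep 3 Lc) m) (Lc ^ m) Wf)) μ ν - 0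
        - ∑ b ∈ (univ : Finset (Fin 4 → Fin (Lc ^ m))).image resSite, ((((Lc ^ m : ℕ) : ℝ)) ^ 4)⁻¹ *
            ∑ w ∈ annulus 4 0 R₀, toReal w μ * toReal w ν * ∑ i ∈ s, cc₀ i * (F' b i w * G' b i w)|
      ≤ U₁ + 80 * E * (1 + Lr / δ) := by
  have hn : 1 ≤ Lc ^ m := Nat.one_le_pow _ _ (by omega)
  have hg := secondMoment_TPerfOf_perfect_eq_basePoint hLc hm hS hδs hScov hW hδ2 hWcov hWsymm hrow hT1 μ ν
  obtain ⟨hwt0, hwt1⟩ := basePoint_weights (n := Lc ^ m) hn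
  have hwt1' : ∑ _b ∈ (univ : Finset (Fin 4 → Fin (Lc ^ m))).image resSite, ((((Lc ^ m : ℕ) : ℝ)) ^ 4)⁻¹ = 1 := hwt1
  exact hrep_of_basePoint_uniform (wt := fun _ => ((((Lc ^ m : ℕ) : ℝ)) ^ 4)⁻¹)
    (Φ := fun b w => ((((Lc ^ m : ℕ) : ℝ)) ^ 8)⁻¹ * (toReal w μ * toReal w ν *
      baseKer (fineHessA (axDressK (Lc ^ m) (KPerf (d := 3) Lc (sfStep Lc) (smStep 3 Lc) m)) (coProj (Lc ^ m) S) Wf μ ν) b w))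
    hg (fun b hb => hwt0 b hb) hwt1' hMR hE hδ hL hlegs htail

end Summit.QuantumFields.BalabanUV.Beta.FP.RepSeam

end
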